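import Mathlib
import HarnessLib

/-!
# The √2-apex calculus of ROUND-27 (T-27.1 (a)+(c′)): the borderline frequency ODE, Ghidaglia's
# full-square algebra, and the quotient-rule assembly «identities ⇒ 2 ≤ C²»
# (item `TerminalTrace.TypeITraceScarL3`, stmt-NavierStokesRegularity-18385, Stub LOUD line; helpers)

LANDING PLATE prepared by the planner-of-record nsreg-p2 g29 (cell ns-regularity-ideate) for a PROVER seat
(`--supports stmt-NavierStokesRegularity-18385`; the planner role lands nothing, DIRECTOR-NS #100).  Pure real
analysis, Mathlib-only, theorems only (0 defs, 0 facts, 0 sorries).  ONE file for the whole calculus SECTION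
of ROUND-27 (D-0064): it subsumes the typer's single-lemma plate `TerminalTraceTypeITraceScarL3FrequencyODE.lean`
(nsreg-typer g21, 02:43:57Z — same statement VERBATIM under the same name `one_le_exponent_of_frequencyODE`,
independent proof); land ONE of the two files for that lemma, not both (same fully-qualified name).

CONTENT (ROUND-27 §1 (iii)–(vi); companion `HOME/ns-regularity-ideate-p2/R27-sqrt2-apex.lean` v2, where the
same three theorems are kernel-checked inside the `Cruxes.…SqrtTwoApex` namespace):
* `one_le_exponent_of_frequencyODE` — on `(s₁,0)`: `E > 0`, `Λ ≥ 0`, `E' ≥ −2ΛE − g₀(−s)^{-1/2}E`,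
  `Λ' ≤ (p/(−s) + a₀(−s)^{-1/2})Λ + b₀(−s)^{-1/2}`, `E → 0` as `s → 0⁻` ⇒ `1 ≤ p`.  (Integrating factor
  `(−s)^q e^{2a₀√(−s)}` with `q = max p ½`, mean-value inequality, monotone barrier `log E − Φ`.)
* `ghidaglia_algebra` — `0 ≤ Q → 0 ≤ D → |X| ≤ β√Q√D → −2Q + 2X ≤ ½β²D` (the FULL square; Temam IDDS 1997
  Ch. III Lemma 6.1 (6.11) keeps half of it and gets `2k²`).
* `two_le_rateSq_of_identities` — the quotient rule for `Λ = D/E` fed with the energy identity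
  `E' = −2D + 2S₁`, the enstrophy identity `D' = −2Q₀ + 2X − 2S₂`, `D² ≤ EQ₀`, shell-source bounds
  `|S₁| ≤ m₁`, `|S₂| ≤ m₂`, the drift pairing bound `|X| ≤ β√(Q₀ − D²/E)√D` with `β² ≤ C²/(−s)`, the floor
  `E ≥ c√(−s)` and extinction `E → 0` ⇒ `2 ≤ C²`.  With this, T27-A (`RateSqThreshold`) of ROUND-27 is
  reduced to the single PDE target T27-A′ (`IdentityPackage`: these identities for the cut-off classical
  representative of an extinct Type-I apex that is quiet on a shell).
The borderline coefficient `p/(−s)` (Type-I drift `k = C(−s)^{-1/2} ∉ L²_t`) is exactly what the printed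
log-convexity backward-uniqueness lemmas exclude (tree, bounded coefficient:
`Literature.Analysis.ODE.eq_zero_of_dirichletQuotient_law`, `Literature.Analysis.ODE.pos_of_dirichletQuotient_law`;
abstract form `eq_zero_of_abstractParabolic_backward`); the threshold `p = 1` is sharp (backward Gaussian,
ROUND-27 §3; classical analogue: Nagumo's constant `1` in `[b(·,t)]_{Lip} ≤ 1/t`, Giga–Giga 2023 p.32).
WHAT THIS IS NOT: not T27-A, not Stub LOUD, not item 18385, not NS regularity — three lemmas about real
functions and real numbers.
[folklore; Temam1997 Ch. III §6; Ghidaglia1986; Kukavica2007 doi:10.1090/s0002-9939-07-08991-5]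
-/

open Set Filter Topology

set_option linter.dupNamespace false

namespace Summit.NavierStokesRegularity.NavierStokesRegularity.Theorems.TypeITraceScarL3

/-- The borderline frequency ODE: a positive `E` with `E → 0` at `0⁻` and a frequency `Λ ≥ 0` obeying
`Λ' ≤ (p/(−s) + a₀/√(−s))Λ + b₀/√(−s)`, `E' ≥ −2ΛE − g₀E/√(−s)` force `1 ≤ p`. -/
theorem one_le_exponent_of_frequencyODE :
    ∀ (p a₀ b₀ g₀ s₁ : ℝ) (E Λ E' Λ' : ℝ → ℝ), s₁ < 0 → 0 ≤ a₀ → 0 ≤ b₀ → 0 ≤ g₀ →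
      (∀ s ∈ Ioo s₁ 0, 0 < E s) → (∀ s ∈ Ioo s₁ 0, 0 ≤ Λ s) →
      (∀ s ∈ Ioo s₁ 0, HasDerivAt E (E' s) s) → (∀ s ∈ Ioo s₁ 0, HasDerivAt Λ (Λ' s) s) →
      (∀ s ∈ Ioo s₁ 0, -2 * Λ s * E s - g₀ / Real.sqrt (-s) * E s ≤ E' s) →
      (∀ s ∈ Ioo s₁ 0, Λ' s ≤ (p / (-s) + a₀ / Real.sqrt (-s)) * Λ s + b₀ / Real.sqrt (-s)) →
      Tendsto E (𝓝[<] 0) (𝓝 0) →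
      1 ≤ p := by
  intro p a₀ b₀ g₀ s₁ E Λ E' Λ' hs₁ ha₀ hb₀ hg₀ hEpos hΛnn hE hΛ hE' hΛ' hext
  by_contra hp
  push Not at hp
  -- enlarge `p` to `q ∈ [1/2, 1)`
  set q : ℝ := max p (1 / 2) with hq_def
  have hq1 : q < 1 := max_lt hp (by norm_num)
  have hq_half : (1 : ℝ) / 2 ≤ q := le_max_right _ _
  have hpq : p ≤ q := le_max_left _ _
  have hq0 : 0 < q := by linarith
  have hneg : ∀ s ∈ Ioo s₁ 0, 0 < -s := fun s hs => by linarith [hs.2]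
  have hΛ'q : ∀ s ∈ Ioo s₁ 0,
      Λ' s ≤ (q / (-s) + a₀ / Real.sqrt (-s)) * Λ s + b₀ / Real.sqrt (-s) := by
    intro s hs
    have h1 := hΛ' s hs
    have h2 : p / (-s) ≤ q / (-s) := div_le_div_of_nonneg_right hpq (hneg s hs).le
    have h3 := hΛnn s hs
    nlinarith
  -- integrating factor `φ(s) = (-s)^q · exp (2 a₀ √(-s))`
  set φ : ℝ → ℝ := fun s => (-s) ^ q * Real.exp (2 * a₀ * Real.sqrt (-s)) with hφ_def
  have hφpos : ∀ s ∈ Ioo s₁ 0, 0 < φ s := fun s hs =>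
    mul_pos (Real.rpow_pos_of_pos (hneg s hs) q) (Real.exp_pos _)
  have hφder : ∀ s ∈ Ioo s₁ 0,
      HasDerivAt φ (-(q / (-s) + a₀ / Real.sqrt (-s)) * φ s) s := by
    intro s hs
    have hs0 : -s ≠ 0 := (hneg s hs).ne'
    have hsq : 0 < Real.sqrt (-s) := Real.sqrt_pos.mpr (hneg s hs)
    have h1 : HasDerivAt (fun s : ℝ => (-s) ^ q) ((-1) * q * (-s) ^ (q - 1)) s :=
      (hasDerivAt_neg s).rpow_const (Or.inl hs0)
    have h2 : HasDerivAt (fun s : ℝ => Real.sqrt (-s)) ((-1) / (2 * Real.sqrt (-s))) s :=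
      (hasDerivAt_neg s).sqrt hs0
    have h3 : HasDerivAt (fun s : ℝ => Real.exp (2 * a₀ * Real.sqrt (-s)))
        (Real.exp (2 * a₀ * Real.sqrt (-s)) * (2 * a₀ * ((-1) / (2 * Real.sqrt (-s))))) s :=
      (h2.const_mul (2 * a₀)).exp
    have h4 : HasDerivAt φ _ s := h1.mul h3
    refine h4.congr_deriv ?_
    simp only [hφ_def]
    rw [Real.rpow_sub_one hs0 q]
    field_simp
    ring
  -- `F = φ Λ` has derivative bounded above by the constant `B`
  set B : ℝ := (-s₁) ^ (q - 1 / 2) * Real.exp (2 * a₀ * Real.sqrt (-s₁)) * b₀ with hB_def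
  have hBnn : 0 ≤ B := by
    have : 0 ≤ (-s₁) ^ (q - 1 / 2) := Real.rpow_nonneg (by linarith) _
    positivity
  set F : ℝ → ℝ := fun s => φ s * Λ s with hF_def
  have hFder : ∀ s ∈ Ioo s₁ 0,
      HasDerivAt F (-(q / (-s) + a₀ / Real.sqrt (-s)) * φ s * Λ s + φ s * Λ' s) s :=
    fun s hs => (hφder s hs).mul (hΛ s hs)
  have hFder_le : ∀ s ∈ Ioo s₁ 0,
      -(q / (-s) + a₀ / Real.sqrt (-s)) * φ s * Λ s + φ s * Λ' s ≤ B := by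
    intro s hs
    have hs0 : 0 < -s := hneg s hs
    have hsq : 0 < Real.sqrt (-s) := Real.sqrt_pos.mpr hs0
    have hφs := hφpos s hs
    -- first: `≤ φ s * (b₀ / √(-s))`
    have step1 : -(q / (-s) + a₀ / Real.sqrt (-s)) * φ s * Λ s + φ s * Λ' s
        ≤ φ s * (b₀ / Real.sqrt (-s)) := by
      have h := hΛ'q s hs
      have : φ s * Λ' s ≤ φ s * ((q / (-s) + a₀ / Real.sqrt (-s)) * Λ s + b₀ / Real.sqrt (-s)) :=
        mul_le_mul_of_nonneg_left h hφs.le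
      nlinarith
    -- second: `φ s * (b₀ / √(-s)) = (-s)^(q-1/2) * exp(…) * b₀ ≤ B`
    have hpow : (-s) ^ q / Real.sqrt (-s) = (-s) ^ (q - 1 / 2) := by
      rw [Real.sqrt_eq_rpow, ← Real.rpow_sub hs0]
    have step2 : φ s * (b₀ / Real.sqrt (-s))
        = (-s) ^ (q - 1 / 2) * Real.exp (2 * a₀ * Real.sqrt (-s)) * b₀ := by
      rw [← hpow]
      simp only [hφ_def]
      field_simp
    have step3 : (-s) ^ (q - 1 / 2) * Real.exp (2 * a₀ * Real.sqrt (-s)) * b₀ ≤ B := by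
      have e1 : (-s) ^ (q - 1 / 2) ≤ (-s₁) ^ (q - 1 / 2) :=
        Real.rpow_le_rpow hs0.le (by linarith [hs.1]) (by linarith)
      have e2 : Real.exp (2 * a₀ * Real.sqrt (-s)) ≤ Real.exp (2 * a₀ * Real.sqrt (-s₁)) := by
        apply Real.exp_le_exp.mpr
        have : Real.sqrt (-s) ≤ Real.sqrt (-s₁) := Real.sqrt_le_sqrt (by linarith [hs.1])
        nlinarith
      have e3 : 0 ≤ (-s) ^ (q - 1 / 2) := Real.rpow_nonneg hs0.le _
      have e4 : 0 ≤ Real.exp (2 * a₀ * Real.sqrt (-s₁)) := (Real.exp_pos _).le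
      calc (-s) ^ (q - 1 / 2) * Real.exp (2 * a₀ * Real.sqrt (-s)) * b₀
          ≤ (-s₁) ^ (q - 1 / 2) * Real.exp (2 * a₀ * Real.sqrt (-s₁)) * b₀ := by
            apply mul_le_mul_of_nonneg_right _ hb₀
            exact mul_le_mul e1 e2 (Real.exp_pos _).le (le_trans e3 e1)
        _ = B := by rw [hB_def]
    linarith [step1, step2 ▸ step3]
  -- mean value inequality on `Ioo s₁ 0`
  have hconv : Convex ℝ (Ioo s₁ (0 : ℝ)) := convex_Ioo _ _
  have hFcont : ContinuousOn F (Ioo s₁ 0) := fun s hs =>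
    (hFder s hs).continuousAt.continuousWithinAt
  have hFdiff : DifferentiableOn ℝ F (interior (Ioo s₁ 0)) := by
    rw [interior_Ioo]; exact fun s hs => (hFder s hs).differentiableAt.differentiableWithinAt
  have hFderiv_le : ∀ s ∈ interior (Ioo s₁ (0 : ℝ)), deriv F s ≤ B := by
    rw [interior_Ioo]; intro s hs; rw [(hFder s hs).deriv]; exact hFder_le s hs
  have hMV := hconv.image_sub_le_mul_sub_of_deriv_le hFcont hFdiff hFderiv_le
  -- the bound `Λ s ≤ K₁ (-s)^(-q)` on `[s₂, 0)`
  set s₂ : ℝ := s₁ / 2 with hs₂_def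
  have hs₂mem : s₂ ∈ Ioo s₁ 0 := ⟨by rw [hs₂_def]; linarith, by rw [hs₂_def]; linarith⟩
  set K₁ : ℝ := F s₂ + B * (-s₂) with hK₁_def
  have hK₁nn : 0 ≤ K₁ := by
    have : 0 ≤ F s₂ := mul_nonneg (hφpos s₂ hs₂mem).le (hΛnn s₂ hs₂mem)
    have : 0 ≤ B * (-s₂) := mul_nonneg hBnn (hneg s₂ hs₂mem).le
    linarith
  have hΛbd : ∀ s ∈ Ico s₂ 0, Λ s ≤ K₁ * (-s) ^ (-q) := by
    intro s hs
    have hs' : s ∈ Ioo s₁ 0 := ⟨lt_of_lt_of_le hs₂mem.1 hs.1, hs.2⟩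
    have hs0 : 0 < -s := hneg s hs'
    have h1 : F s - F s₂ ≤ B * (s - s₂) := hMV s₂ hs₂mem s hs' hs.1
    have h2 : F s ≤ K₁ := by
      have : B * (s - s₂) ≤ B * (-s₂) := mul_le_mul_of_nonneg_left (by linarith [hs.2]) hBnn
      rw [hK₁_def]; linarith
    have hφs := hφpos s hs'
    have h3 : Λ s ≤ K₁ / φ s := by
      rw [le_div_iff₀ hφs]; simpa [hF_def, mul_comm] using h2
    have h4 : (-s) ^ q ≤ φ s := by
      simp only [hφ_def]
      have : 1 ≤ Real.exp (2 * a₀ * Real.sqrt (-s)) := by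
        apply Real.one_le_exp
        have := Real.sqrt_nonneg (-s)
        positivity
      have hp0 : 0 ≤ (-s) ^ q := Real.rpow_nonneg hs0.le _
      nlinarith
    have h5 : K₁ / φ s ≤ K₁ / (-s) ^ q :=
      div_le_div_of_nonneg_left hK₁nn (Real.rpow_pos_of_pos hs0 q) h4
    have h6 : K₁ / (-s) ^ q = K₁ * (-s) ^ (-q) := by
      rw [Real.rpow_neg hs0.le, div_eq_mul_inv]
    linarith [h6 ▸ h5]
  -- lower barrier for `log E` on `(s₂, 0)`
  set Φ : ℝ → ℝ := fun s => 2 * K₁ / (1 - q) * (-s) ^ (1 - q) + 2 * g₀ * Real.sqrt (-s)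
    with hΦ_def
  have hΦnn : ∀ s ∈ Ioo s₁ 0, 0 ≤ Φ s := by
    intro s hs
    have hs0 : 0 < -s := hneg s hs
    have : 0 ≤ (-s) ^ (1 - q) := Real.rpow_nonneg hs0.le _
    have : 0 < 1 - q := by linarith
    have := Real.sqrt_nonneg (-s)
    simp only [hΦ_def]
    positivity
  have hΦder : ∀ s ∈ Ioo s₁ 0,
      HasDerivAt Φ (-(2 * K₁) * (-s) ^ (-q) - g₀ / Real.sqrt (-s)) s := by
    intro s hs
    have hs0 : -s ≠ 0 := (hneg s hs).ne'
    have hsq : 0 < Real.sqrt (-s) := Real.sqrt_pos.mpr (hneg s hs)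
    have h1 : HasDerivAt (fun s : ℝ => (-s) ^ (1 - q)) ((-1) * (1 - q) * (-s) ^ ((1 - q) - 1)) s :=
      (hasDerivAt_neg s).rpow_const (Or.inl hs0)
    have h2 : HasDerivAt (fun s : ℝ => Real.sqrt (-s)) ((-1) / (2 * Real.sqrt (-s))) s :=
      (hasDerivAt_neg s).sqrt hs0
    have h3 : HasDerivAt Φ _ s := (h1.const_mul (2 * K₁ / (1 - q))).add (h2.const_mul (2 * g₀))
    refine h3.congr_deriv ?_
    have h1q : (1 - q) - 1 = -q := by ring
    rw [h1q]
    have : (1 : ℝ) - q ≠ 0 := by linarith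
    field_simp
    ring
  set Ψ : ℝ → ℝ := fun s => Real.log (E s) - Φ s with hΨ_def
  have hΨder : ∀ s ∈ Ioo s₂ 0,
      HasDerivAt Ψ (E' s / E s - (-(2 * K₁) * (-s) ^ (-q) - g₀ / Real.sqrt (-s))) s := by
    intro s hs
    have hs' : s ∈ Ioo s₁ 0 := ⟨lt_trans hs₂mem.1 hs.1, hs.2⟩
    exact ((hE s hs').log (hEpos s hs').ne').sub (hΦder s hs')
  have hΨder_nn : ∀ s ∈ Ioo s₂ 0,
      0 ≤ E' s / E s - (-(2 * K₁) * (-s) ^ (-q) - g₀ / Real.sqrt (-s)) := by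
    intro s hs
    have hs' : s ∈ Ioo s₁ 0 := ⟨lt_trans hs₂mem.1 hs.1, hs.2⟩
    have hEs := hEpos s hs'
    have h1 : -2 * Λ s - g₀ / Real.sqrt (-s) ≤ E' s / E s := by
      rw [le_div_iff₀ hEs]
      have := hE' s hs'
      nlinarith
    have h2 := hΛbd s ⟨hs.1.le, hs.2⟩
    nlinarith
  have hconv₂ : Convex ℝ (Ioo s₂ (0 : ℝ)) := convex_Ioo _ _
  have hΨcont : ContinuousOn Ψ (Ioo s₂ 0) := fun s hs =>
    (hΨder s hs).continuousAt.continuousWithinAt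
  have hΨdiff : DifferentiableOn ℝ Ψ (interior (Ioo s₂ 0)) := by
    rw [interior_Ioo]; exact fun s hs => (hΨder s hs).differentiableAt.differentiableWithinAt
  have hΨderiv_nn : ∀ s ∈ interior (Ioo s₂ (0 : ℝ)), 0 ≤ deriv Ψ s := by
    rw [interior_Ioo]; intro s hs; rw [(hΨder s hs).deriv]; exact hΨder_nn s hs
  have hmono : MonotoneOn Ψ (Ioo s₂ 0) :=
    monotoneOn_of_deriv_nonneg hconv₂ hΨcont hΨdiff hΨderiv_nn
  -- uniform positive lower bound for `E` on `[s₃, 0)`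
  set s₃ : ℝ := s₂ / 2 with hs₃_def
  have hs₃mem : s₃ ∈ Ioo s₂ 0 := ⟨by rw [hs₃_def]; linarith [hs₂mem.2], by rw [hs₃_def]; linarith [hs₂mem.2]⟩
  set L : ℝ := Real.exp (Ψ s₃) with hL_def
  have hLpos : 0 < L := Real.exp_pos _
  have hElb : ∀ s ∈ Ico s₃ 0, L ≤ E s := by
    intro s hs
    have hs' : s ∈ Ioo s₂ 0 := ⟨lt_of_lt_of_le hs₃mem.1 hs.1, hs.2⟩
    have hs'' : s ∈ Ioo s₁ 0 := ⟨lt_trans hs₂mem.1 hs'.1, hs.2⟩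
    have h1 : Ψ s₃ ≤ Ψ s := hmono hs₃mem hs' hs.1
    have h2 : Ψ s₃ ≤ Real.log (E s) := by
      have := hΦnn s hs''
      simp only [hΨ_def] at h1 ⊢
      linarith
    calc L = Real.exp (Ψ s₃) := rfl
      _ ≤ Real.exp (Real.log (E s)) := Real.exp_le_exp.mpr h2
      _ = E s := Real.exp_log (hEpos s hs'')
  -- contradiction with extinction
  have hev1 : ∀ᶠ s in 𝓝[<] (0 : ℝ), E s < L := hext (eventually_lt_nhds hLpos)
  have hev2 : ∀ᶠ s in 𝓝[<] (0 : ℝ), s ∈ Ioo s₃ 0 := Ioo_mem_nhdsLT hs₃mem.2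
  obtain ⟨s, hs1, hs2⟩ := (hev1.and hev2).exists
  have := hElb s ⟨hs2.1.le, hs2.2⟩
  linarith


/-- Ghidaglia's full-square algebra: `−2Q + 2X ≤ ½β²D` when `|X| ≤ β√Q√D`. -/
theorem ghidaglia_algebra {Q D X β : ℝ} (hQ : 0 ≤ Q) (hD : 0 ≤ D)
    (hX : |X| ≤ β * Real.sqrt Q * Real.sqrt D) :
    -2 * Q + 2 * X ≤ (1 / 2) * β ^ 2 * D := by
  have hXle : X ≤ β * Real.sqrt Q * Real.sqrt D := (le_abs_self X).trans hX
  have hsq : Real.sqrt Q ^ 2 = Q := Real.sq_sqrt hQ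
  have hsd : Real.sqrt D ^ 2 = D := Real.sq_sqrt hD
  nlinarith [sq_nonneg (2 * Real.sqrt Q - β * Real.sqrt D), hsq, hsd, Real.sqrt_nonneg Q,
    Real.sqrt_nonneg D]

/-- Ghidaglia calculus: the identity package of the cut-off velocity forces `2 ≤ C²`. -/
theorem two_le_rateSq_of_identities
    {C c m₁ m₂ s₁ : ℝ} {E D Q₀ S₁ S₂ X β : ℝ → ℝ}
    (hs₁ : s₁ < 0) (hc : 0 < c) (hm₁ : 0 ≤ m₁) (hm₂ : 0 ≤ m₂)
    (hfloor : ∀ s ∈ Ioo s₁ 0, c * Real.sqrt (-s) ≤ E s)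
    (hDnn : ∀ s ∈ Ioo s₁ 0, 0 ≤ D s)
    (hCS : ∀ s ∈ Ioo s₁ 0, D s ^ 2 ≤ E s * Q₀ s)
    (hE : ∀ s ∈ Ioo s₁ 0, HasDerivAt E (-2 * D s + 2 * S₁ s) s)
    (hD : ∀ s ∈ Ioo s₁ 0, HasDerivAt D (-2 * Q₀ s + 2 * X s - 2 * S₂ s) s)
    (hS₁ : ∀ s ∈ Ioo s₁ 0, |S₁ s| ≤ m₁) (hS₂ : ∀ s ∈ Ioo s₁ 0, |S₂ s| ≤ m₂)
    (hβ : ∀ s ∈ Ioo s₁ 0, 0 ≤ β s ∧ β s ^ 2 ≤ C ^ 2 / (-s))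
    (hX : ∀ s ∈ Ioo s₁ 0,
      |X s| ≤ β s * Real.sqrt (Q₀ s - D s ^ 2 / E s) * Real.sqrt (D s))
    (hext : Tendsto E (𝓝[<] 0) (𝓝 0)) :
    2 ≤ C ^ 2 := by
  have hneg : ∀ s ∈ Ioo s₁ 0, 0 < -s := fun s hs => by linarith [hs.2]
  have hsqrt : ∀ s ∈ Ioo s₁ 0, 0 < Real.sqrt (-s) := fun s hs => Real.sqrt_pos.mpr (hneg s hs)
  have hEpos : ∀ s ∈ Ioo s₁ 0, 0 < E s := fun s hs =>
    lt_of_lt_of_le (mul_pos hc (hsqrt s hs)) (hfloor s hs)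
  -- the Dirichlet quotient and its derivative
  set Λ : ℝ → ℝ := fun s => D s / E s with hΛ_def
  set Λ' : ℝ → ℝ := fun s =>
    ((-2 * Q₀ s + 2 * X s - 2 * S₂ s) * E s - D s * (-2 * D s + 2 * S₁ s)) / E s ^ 2 with hΛ'_def
  have hΛder : ∀ s ∈ Ioo s₁ 0, HasDerivAt Λ (Λ' s) s := fun s hs =>
    (hD s hs).div (hE s hs) (hEpos s hs).ne'
  have hΛnn : ∀ s ∈ Ioo s₁ 0, 0 ≤ Λ s := fun s hs =>
    div_nonneg (hDnn s hs) (hEpos s hs).le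
  -- the two differential inequalities
  have hE' : ∀ s ∈ Ioo s₁ 0,
      -2 * Λ s * E s - (2 * m₁ / c) / Real.sqrt (-s) * E s ≤ -2 * D s + 2 * S₁ s := by
    intro s hs
    have hEs := hEpos s hs
    have ht := hsqrt s hs
    have h1 : -2 * Λ s * E s = -2 * D s := by simp only [hΛ_def]; field_simp
    have h2 : -m₁ ≤ S₁ s := (abs_le.mp (hS₁ s hs)).1
    have h3 : 2 * m₁ ≤ (2 * m₁ / c) / Real.sqrt (-s) * E s := by
      rw [div_div, div_mul_eq_mul_div, le_div_iff₀ (mul_pos hc ht)]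
      have := hfloor s hs
      nlinarith
    linarith [h1, h2, h3]
  have hΛ'le : ∀ s ∈ Ioo s₁ 0,
      Λ' s ≤ ((C ^ 2 / 2) / (-s) + (2 * m₁ / c) / Real.sqrt (-s)) * Λ s
        + (2 * m₂ / c) / Real.sqrt (-s) := by
    intro s hs
    have hEs := hEpos s hs
    have ht := hsqrt s hs
    have hs0 := hneg s hs
    have hDs := hDnn s hs
    obtain ⟨hβ0, hβC⟩ := hβ s hs
    set Q : ℝ := Q₀ s - D s ^ 2 / E s with hQ_def
    have hQ : 0 ≤ Q := by
      have : D s ^ 2 / E s ≤ Q₀ s := by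
        rw [div_le_iff₀ hEs]; linarith [hCS s hs, mul_comm (E s) (Q₀ s)]
      simp only [hQ_def]; linarith
    have hG : -2 * Q + 2 * X s ≤ (1 / 2) * β s ^ 2 * D s :=
      ghidaglia_algebra hQ hDs (hX s hs)
    -- rewrite Λ'
    have hΛ'eq : Λ' s = (-2 * Q + 2 * X s) / E s - 2 * S₂ s / E s - 2 * Λ s * S₁ s / E s := by
      simp only [hΛ'_def, hΛ_def, hQ_def]
      field_simp
      ring
    -- piece 1
    have p1 : (-2 * Q + 2 * X s) / E s ≤ (C ^ 2 / 2) / (-s) * Λ s := by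
      have a1 : (-2 * Q + 2 * X s) / E s ≤ ((1 / 2) * β s ^ 2 * D s) / E s :=
        div_le_div_of_nonneg_right hG hEs.le
      have a2 : ((1 / 2) * β s ^ 2 * D s) / E s = (1 / 2) * β s ^ 2 * Λ s := by
        simp only [hΛ_def]; ring
      have a3 : (1 / 2) * β s ^ 2 * Λ s ≤ (1 / 2) * (C ^ 2 / (-s)) * Λ s := by
        have := hΛnn s hs
        nlinarith
      have a4 : (1 / 2) * (C ^ 2 / (-s)) * Λ s = (C ^ 2 / 2) / (-s) * Λ s := by ring
      linarith [a1, a2, a3, a4]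
    -- piece 2
    have p2 : -(2 * S₂ s / E s) ≤ (2 * m₂ / c) / Real.sqrt (-s) := by
      have a1 : -(2 * S₂ s / E s) ≤ 2 * m₂ / E s := by
        rw [neg_le, ← neg_div]
        apply div_le_div_of_nonneg_right _ hEs.le
        linarith [(abs_le.mp (hS₂ s hs)).1]
      have a2 : 2 * m₂ / E s ≤ 2 * m₂ / (c * Real.sqrt (-s)) :=
        div_le_div_of_nonneg_left (by linarith) (mul_pos hc ht) (hfloor s hs)
      have a3 : 2 * m₂ / (c * Real.sqrt (-s)) = (2 * m₂ / c) / Real.sqrt (-s) := by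
        rw [div_div]
      linarith [a1, a2, a3]
    -- piece 3
    have p3 : -(2 * Λ s * S₁ s / E s) ≤ (2 * m₁ / c) / Real.sqrt (-s) * Λ s := by
      have hΛs := hΛnn s hs
      have a1 : -(2 * Λ s * S₁ s / E s) ≤ 2 * Λ s * m₁ / E s := by
        rw [neg_le, ← neg_div]
        apply div_le_div_of_nonneg_right _ hEs.le
        have := (abs_le.mp (hS₁ s hs)).1
        nlinarith
      have a2 : 2 * Λ s * m₁ / E s ≤ 2 * Λ s * m₁ / (c * Real.sqrt (-s)) :=
        div_le_div_of_nonneg_left (by positivity) (mul_pos hc ht) (hfloor s hs)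
      have a3 : 2 * Λ s * m₁ / (c * Real.sqrt (-s)) = (2 * m₁ / c) / Real.sqrt (-s) * Λ s := by
        rw [div_div]; ring
      linarith [a1, a2, a3]
    rw [hΛ'eq]
    nlinarith [p1, p2, p3]
  -- the ODE lemma
  have hfreq := one_le_exponent_of_frequencyODE (C ^ 2 / 2) (2 * m₁ / c) (2 * m₂ / c) (2 * m₁ / c) s₁ E Λ
    (fun s => -2 * D s + 2 * S₁ s) Λ' hs₁ (by positivity) (by positivity) (by positivity)
    hEpos hΛnn hE hΛder hE' hΛ'le hext
  linarith

end Summit.NavierStokesRegularity.NavierStokesRegularity.Theorems.TypeITraceScarL3
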